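import Summits.Ventures.HodgeRepro.Statements

/-!
# LitSealedA — printed counting statements in the SEALED degree-6 coordinates of statement (a)

Blind re-derivation cell `pub-hodge-repro`, seat `lit` (gen 3).  Target tree path
`lean/Summits/Ventures/HodgeRepro/LitSealedA.lean` (mirrored in HOME/lit/ until «GATE-BLIND LIVE»).

The sealed statement (a) `RankFourFaceCensus` (`Statements.lean`) states the degree-6 census in coordinates:
CM types are the 3-subsets `T ⊂ ℤ/6` with `i ∈ T ↔ i + 3 ∉ T` (`FaceCensus.Sextic.Coordinates.cmTypes`), the
Galois twists are the translations `T ↦ T + m`, and `T` is induced from the imaginary quadratic subfield iff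
`T + 2 = T` (`isInduced`).  The Props below transcribe, onto exactly that vocabulary, the PRINTED counting
formulas of Kida for the cyclic group `C_{2p}` at `p = 3` — the only printed source the cell holds that counts
CM types of a Galois CM field by its group (SOURCES.md §KI1; the typer-model versions are in LitCMTree.lean).
NO theorem is proved here (seat rule).  Scratch `decide` checks of both Props (not shipped) are recorded in
HOME/lit/INDEX-lit.md.

Source (read AS PRINTED through `lit`; verbatim quotes and store locators in HOME/route/SOURCES.md §KI1):
* [Ki19] Kida, *Counting formulas for CM-types*, Moscow J. Combin. Number Theory 8 (2019) 343–359 — key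
  `paper:doi-10-2140-moscow-2019-8-343`, Example 6.2 (store p0012–p0013): for `G = C_{2p}` with `p` an odd prime
  and `c` its involution, the number of simple (= primitive) CM-types is `2^p − 2` and the number of conjugacy
  classes (Galois-twist orbits) of CM-types is `(2^{p−1} − 1)/p + 1`.
-/

set_option autoImplicit false

namespace Summit.Ventures.HodgeRepro.Lit

open Finset
open FaceCensus.Sextic.Coordinates

/-- **[Ki19] Example 6.2, p = 3, simple count**, in the sealed coordinates: exactly `2^3 − 2 = 6` of the CM types
of `ℤ/6` are NOT induced from the imaginary quadratic subfield (Kida's "simple" = Shimura's "primitive" types; the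
sealed `isInduced T = true ↔ T + 2 = T`). -/
def Kida2019_Ex6_2_sextic_simpleCount : Prop :=
  (cmTypes.filter fun T => isInduced T = false).card = 2 ^ 3 - 2

/-- The Galois-twist orbit `{T + m | m ∈ ℤ/6}` of a type in the sealed coordinates. -/
def twistOrbit (T : Finset (ZMod 6)) : Finset (Finset (ZMod 6)) :=
  (univ : Finset (ZMod 6)).image fun m => T.image fun i => i + m

/-- **[Ki19] Example 6.2, p = 3, class count**, in the sealed coordinates: the CM types of `ℤ/6` fall into exactly
`(2^{3−1} − 1)/3 + 1 = 2` orbits under the twists `T ↦ T + m` (the induced pair `{0,2,4}, {1,3,5}` and the six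
primitive translates of `{0,1,2}` — the two classes the sealed `Census` conjunct (1) names). -/
def Kida2019_Ex6_2_sextic_classCount : Prop :=
  (cmTypes.image twistOrbit).card = (2 ^ (3 - 1) - 1) / 3 + 1

end Summit.Ventures.HodgeRepro.Lit
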